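import Summits.QuantumFields.YangMills.Theorems.BalabanUVNodesN19ClassSandwichAtRecord
import Summits.QuantumFields.YangMills.Theorems.BalabanUVNodesN14ConvexFibreCauchy

/-!
# BalabanUVNodes ∕ N19 → N14 — THE U3 FACE FOR N14 AT THE RECORD's KEYS: SHAPE_cl in DENSITY FORM for the two runs' class measures of slots pushed to the
# unit lattice ⇒ N14's binder `TiltedMeanMatching … η` with `Summable η` for MODULE B's observables and class measures — the N14 twin of module 26
# `…N19ClassSandwichAtRecord` (`hS` ↦ `hD`, `Core` ↦ `TiltedMeanMatching`), plus the JOINT face (MASS_cl ∧ SHAPE-density ⇒ `Core` AND `TiltedMeanMatching`)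

Cell `pub-ymgap` (HUMAN RULING D-0062 Track A; director-ym №197 ∕ HUMAN RULING D-0149 width push), WIDTH SEAT `pub-ymgap-dag-n19-w2` (g0), plan g77
`W-SEAT-START-LIST.md` v3 §2 n19 ITEM 2 (w2) = dag-n19-d g22's (3′) «§N19 s1's U3 face for N14: the displayed U3 read-out sentence N14 needs, typed once at the
record and handed to n14-w1».  Filed `--kind proof --supports stmt-QuantumFields-20544 --as helper` (K3⁷ `SpineGivenEndpointR13SepCoPH`).  COUNT-NEUTRAL.  THEOREMS ONLY
(0 `def`); imports dag-n19-d's module 26 `…N19ClassSandwichAtRecord` (p500938 ∕ v1.1 p505620; through it n19-c's `…N19ClassSandwichRoad` p496221, MODULE B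
`…N19MGFFormAtRecord` p494399 ∕ p497235, ne1 gen 2 `DressedMGFFormUnitLattice`) and n14-c's `…N14ConvexFibreCauchy` (`tiltedMean_map`, `summable_exp_sub_one`) ONLY; every cited
lemma BY NAME; edits nothing.

WHY (director-ym №195 (8), READING (a); LENS-control v5.1∕v6.2 (E1)–(E6); dag-n14-w1 g0 INBOX l.24096 (i)).  At the record N14 (NE1′) has no producer estimate of its own:
what node U3's class-level output discharges is N14's DOWNSTREAM binder `DressedMGFForm.TiltedMeanMatching` (:253) for the unit-scale observables `W ∘ A_K` — produced on ONE
space by n19-c's `N19ClassSandwichRoad.tiltedMeanMatching_of_shapeDensity` (SHAPE_cl in density form ⇒ `TiltedMeanMatching … (K ↦ B(e^{2r_K} − 1))`).  Module 26 typed the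
`Core` face of the class sandwich AT THE RECORD's KEYS (two runs on their OWN field spaces keyed to the unit lattice, MODULE B's class measures of slots); the N14 face —
the SAME pushed-forward class measures, SHAPE_cl in density form, conclusion on the runs' OWN spaces and observables `prodObs (D.scheme g₀) (p· K).K os` — was not in the
tree.  Its conclusion is LITERALLY the (I)-slot `TiltedMeanMatching (cr …).l₀ (cr …).T (cr …).Bad Fo ν Fo' ν' η ∧ Summable η` of dag-n19-d's 24bᴴ
`…TargetAtHomes13CoPHOnVacuumMGF.towerEdge₁₃CoPHOn_of_vacuumCoreMGFReading` once a reading keys `Fo ν Fo' ν'` to MODULE B's objects.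
* §1 [folklore, GENERIC two keys] `tiltedMeanMatching_of_shapeDensity_map₂` · `summable_mul_exp_two_mul_sub_one` · `exists_tiltedMeanMatching_summable_of_shapeDensity_map₂` ·
  ★ `core_and_tiltedMeanMatching_of_mass_of_shapeDensity_map₂` (MASS_cl(`r₁`) of the pushed-forward class masses + SHAPE_cl(`r₂`) in density form + two MGF forms ⇒ the dressed
  `Spine.NE7.Core` (width `r₁ + 2r₂ ≤ vol·δ`; n19-c `shapeSandwich_of_shapeDensity` ∕ `classSandwich_of_mass_of_shape` + module 26 `core_of_classSandwich_map₂`) AND N14's binder — ONE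
  displayed U3 sentence pair serves N19 and N14).
* §2 at general key LEVELS of ONE scheme (MODULE B's output shape): `tiltedMeanMatching_of_shapeDensity_atKeys` · `core_and_tiltedMeanMatching_of_mass_of_shapeDensity_atKeys`.
* §3 ★ AT THE RECORD's KEYS (module 26's binder prefix VERBATIM, `hS` ↦ `hSh`): `tiltedMeanMatching_classMeasureOfSlots_of_shapeDensity` · `…_of_localBg` ·
  `exists_tiltedMeanMatching_summable_classMeasureOfSlots_of_shapeDensity` · ★ `core_and_tiltedMeanMatching_classWeightOfDatum₉_of_mass_of_shapeDensity`.
SUPPORT CAVEAT (n19-c `…N19CoreTVInvariant`, p504410).  SHAPE_cl in density form forces, class by class, MUTUAL ABSOLUTE CONTINUITY of the two pushed-forward class laws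
(equal supports on the unit lattice); the observable-uniform `Core` is EQUIVALENT to the support-tolerant MASS_cl ∧ TV_cl, and TV_cl alone gives N14's binder — that
edition of this face is the sibling module `…N19ShapeFaceN14AtRecordTV` (same seat).  `hSh` is what a density-producing expansion hands; `hTV` is what `Core` needs.

THE U3 READ-OUT SENTENCE (displayed hypothesis `hSh`, at the record's keys; handed to n14-w1 BY NAME): for every `K`, every source `|t| ≤ l₀` and every class `τ` good at `t`
there are a constant `c` and a measurable `g` on the unit-lattice field space `GaugeField (F.P 0) 0 (SU N)` with `|g| ≤ r K` such that run B's class measure of slots pushed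
forward by `A_{(pB K).K}` EQUALS `e^{c}` times run A's pushed forward by `A_{(pA K).K}` with density `e^{g}` — SHAPE_cl in density form (the intra-class half of NE7-S_cl; lens
decomp v6 MS-SPLIT), i.e. U3's pointwise class-density comparison read on the unit lattice.

HONEST FRAMING.  ZERO ESTIMATE CONTENT: `hSh` (and `hM`) are HYPOTHESIS SHAPES — UNPRINTED two-run statements for d = 4 ([Balaban1985UV3] (41) p.266 ∕ (47) p.267 print the
Z-level for d = 3), produced by nobody; order arithmetic on measures and integrals + by-name compositions; nothing of Bałaban's instantiated or asserted; NE7 ∕ NE1′ NOT PRINTED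
as two-run statements and NOT PROVED; N14 ∕ N19 NOT discharged (N19 0∕1); K3⁷ OPEN, NOT claimed; counts UNMOVED (typed 28∕28 · discharged 5∕27, A 5∕28); one finite four-torus
programme at fixed `ε = L^{−K}`, Bałaban AS PRINTED — NOT ℝ⁴, NOT infinite volume, NOT OS, NOT a mass gap, NOT Clay: R4 closes the conditional finite-𝕋⁴ rung `BalabanLadder.UV`
only.  0 `def`; 0 `sorry`; standard axioms; no decl below carries a cite tag.
-/

set_option autoImplicit false

noncomputable section

open MeasureTheory ProbabilityTheory
open scoped ENNReal Matrix.Norms.L2Operator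

namespace Summit.QuantumFields.YangMills.BalabanUVNodes.N19ShapeFaceN14AtRecord

open Summit.QuantumFields.BalabanUV.T4Continuum.NE1p.DressedMGFForm (tiltedMean MGFForm TiltedMeanMatching)
open Summit.QuantumFields.BalabanUV.T4Continuum.Spine.NE7 (Core)
open Summit.QuantumFields.YangMills.BalabanUVNodes.N19ClassSandwichRoad
open Summit.QuantumFields.YangMills.BalabanUVNodes.N19ClassSandwichAtRecord
open YMDAG.N14.ConvexFibreCauchy (tiltedMean_map summable_exp_sub_one)
open Literature.MathematicalPhysics.QuantumFieldTheory.Balaban1983to89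

/-! ## §1 GENERIC, TWO KEYS: SHAPE_cl in density form on the unit lattice ⇒ N14's binder on the runs' own spaces -/

section TwoKeys

variable {X : Type*} [MeasurableSpace X] {ΩA ΩB : ℕ → Type*} [∀ K, MeasurableSpace (ΩA K)] [∀ K, MeasurableSpace (ΩB K)]
  {ι : Type*} [DecidableEq ι] {l₀ vol B : ℝ} {T : ℕ → Finset ι} {Bad : ℕ → ℝ → Finset ι} {φ : X → ℝ}
  {a : ∀ K, ΩA K → X} {b : ∀ K, ΩB K → X}
  {νA : ∀ K, ι → Measure (ΩA K)} {νB : ∀ K, ι → Measure (ΩB K)} {P Q : ℕ → ℝ → ι → ℝ} {r r₁ r₂ δ : ℕ → ℝ}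

/-- **THE U3 FACE FOR N14, TWO KEYS** [folklore]: two runs on their OWN field spaces `ΩA K`, `ΩB K`, read to ONE space `X` by measurable key maps `a K`, `b K`; ONE
bounded measurable unit-lattice observable `φ` (`|φ| ≤ B`); finite class measures `νA K τ` on the classes of `T K`; and the DISPLAYED U3 READ-OUT SENTENCE `hD` — SHAPE_cl in
density form for the PUSHED-FORWARD class measures: on every class good at an admissible source, `(νB K τ).map (b K) = e^{c} • ((νA K τ).map (a K)).withDensity e^{g}` with `g`
measurable, `|g| ≤ r K`.  Then N14's binder holds ON THE RUNS' OWN SPACES for the keyed observables `φ ∘ a K` ∕ `φ ∘ b K` with `η K = B·(e^{2 r K} − 1)`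
(n19-c's same-space `tiltedMeanMatching_of_shapeDensity` on `X` + n14-c's `tiltedMean_map`). [folklore] -/
theorem tiltedMeanMatching_of_shapeDensity_map₂ (ha : ∀ K, Measurable (a K)) (hb : ∀ K, Measurable (b K)) (hφ : Measurable φ)
    (hφb : ∀ u, |φ u| ≤ B) (hB : 0 ≤ B) (hfin : ∀ K, ∀ τ ∈ T K, IsFiniteMeasure (νA K τ))
    (hD : ∀ (K : ℕ) (t : ℝ), |t| ≤ l₀ → ∀ τ ∈ T K \ Bad K t, ∃ (c : ℝ) (g : X → ℝ), Measurable g ∧ (∀ x, |g x| ≤ r K) ∧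
      (νB K τ).map (b K) = ENNReal.ofReal (Real.exp c) • ((νA K τ).map (a K)).withDensity fun x => ENNReal.ofReal (Real.exp (g x)))
    (hr : ∀ K, 0 ≤ r K) :
    TiltedMeanMatching l₀ T Bad (fun K => φ ∘ a K) νA (fun K => φ ∘ b K) νB fun K => B * (Real.exp (2 * r K) - 1) := by
  have h := tiltedMeanMatching_of_shapeDensity (Ω := fun _ => X) (T := T) (Bad := Bad) (l₀ := l₀) (r := r)
    (μA := fun K τ => (νA K τ).map (a K)) (μB := fun K τ => (νB K τ).map (b K)) (W := fun _ => φ)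
    hD hr hB (fun K τ hτ => by haveI := hfin K τ hτ; exact Measure.isFiniteMeasure_map (νA K τ) (a K)) (fun _ => hφ) (fun _ x => hφb x)
  intro K t ht τ hτ s hs
  have hK := h K t ht τ hτ s hs
  rw [tiltedMean_map (hb K) hφ, tiltedMean_map (ha K) hφ] at hK
  exact hK

/-- `K ↦ B·(e^{2 r K} − 1)` is summable when `r ≥ 0` is (n14-c's `summable_exp_sub_one`). [folklore] -/
theorem summable_mul_exp_two_mul_sub_one (hrs : Summable r) (hr : ∀ K, 0 ≤ r K) (B : ℝ) :
    Summable fun K => B * (Real.exp (2 * r K) - 1) :=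
  (summable_exp_sub_one (hrs.mul_left 2) fun K => mul_nonneg zero_le_two (hr K)).mul_left B

/-- **… WITH A SUMMABLE MAJORANT** [folklore]: if moreover `Σ r K < ∞`, the (I)-slot PAIR `∃ η, TiltedMeanMatching … η ∧ Summable η` (the hypotheses `hη`∕`hηs` of
`DressedMGFForm.hybridNE7_of_mgfForm`, `N19VacuumMGFRoad.coreEdge_of_coreZero_mgfForm`). [folklore] -/
theorem exists_tiltedMeanMatching_summable_of_shapeDensity_map₂ (ha : ∀ K, Measurable (a K)) (hb : ∀ K, Measurable (b K))
    (hφ : Measurable φ) (hφb : ∀ u, |φ u| ≤ B) (hB : 0 ≤ B) (hfin : ∀ K, ∀ τ ∈ T K, IsFiniteMeasure (νA K τ))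
    (hD : ∀ (K : ℕ) (t : ℝ), |t| ≤ l₀ → ∀ τ ∈ T K \ Bad K t, ∃ (c : ℝ) (g : X → ℝ), Measurable g ∧ (∀ x, |g x| ≤ r K) ∧
      (νB K τ).map (b K) = ENNReal.ofReal (Real.exp c) • ((νA K τ).map (a K)).withDensity fun x => ENNReal.ofReal (Real.exp (g x)))
    (hr : ∀ K, 0 ≤ r K) (hrs : Summable r) :
    ∃ η : ℕ → ℝ, TiltedMeanMatching l₀ T Bad (fun K => φ ∘ a K) νA (fun K => φ ∘ b K) νB η ∧ Summable η :=
  ⟨_, tiltedMeanMatching_of_shapeDensity_map₂ ha hb hφ hφb hB hfin hD hr, summable_mul_exp_two_mul_sub_one hrs hr B⟩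

/-- **★ THE JOINT FACE: ONE DISPLAYED U3 SENTENCE PAIR SERVES N19 AND N14** [folklore].  Two MGF forms of the SAME unit-lattice observable `φ` read through the keys;
MASS_cl (`hM`): ONE constant per `K` sandwiches the pushed-forward class MASSES, width `r₁ K` (the vacuum bracket (V)); SHAPE_cl in density form (`hD`), width `r₂ K`; and
`r₁ K + 2·r₂ K ≤ vol·δ K`.  Then BOTH the dressed `Spine.NE7.Core l₀ vol T Bad P Q δ` (n19-c `shapeSandwich_of_shapeDensity` + `classSandwich_of_mass_of_shape` + module 26
`core_of_classSandwich_map₂`) AND N14's `TiltedMeanMatching … (K ↦ B·(e^{2 r₂ K} − 1))` hold. [folklore] -/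
theorem core_and_tiltedMeanMatching_of_mass_of_shapeDensity_map₂ (ha : ∀ K, Measurable (a K)) (hb : ∀ K, Measurable (b K))
    (hφ : Measurable φ) (hφb : ∀ u, |φ u| ≤ B) (hP : MGFForm B T (fun K => φ ∘ a K) νA P) (hQ : MGFForm B T (fun K => φ ∘ b K) νB Q)
    (hM : ∀ K : ℕ, ∃ c : ℝ, ∀ t : ℝ, |t| ≤ l₀ → ∀ τ ∈ T K \ Bad K t,
      ENNReal.ofReal (Real.exp (c - r₁ K)) * ((νA K τ).map (a K)) Set.univ ≤ ((νB K τ).map (b K)) Set.univ ∧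
        ((νB K τ).map (b K)) Set.univ ≤ ENNReal.ofReal (Real.exp (c + r₁ K)) * ((νA K τ).map (a K)) Set.univ)
    (hD : ∀ (K : ℕ) (t : ℝ), |t| ≤ l₀ → ∀ τ ∈ T K \ Bad K t, ∃ (c : ℝ) (g : X → ℝ), Measurable g ∧ (∀ x, |g x| ≤ r₂ K) ∧
      (νB K τ).map (b K) = ENNReal.ofReal (Real.exp c) • ((νA K τ).map (a K)).withDensity fun x => ENNReal.ofReal (Real.exp (g x)))
    (hr₂ : ∀ K, 0 ≤ r₂ K) (hw : ∀ K, r₁ K + 2 * r₂ K ≤ vol * δ K) :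
    Core l₀ vol T Bad P Q δ ∧
      TiltedMeanMatching l₀ T Bad (fun K => φ ∘ a K) νA (fun K => φ ∘ b K) νB fun K => B * (Real.exp (2 * r₂ K) - 1) := by
  refine ⟨?_, tiltedMeanMatching_of_shapeDensity_map₂ ha hb hφ hφb hP.nonneg hP.finite hD hr₂⟩
  have hfin : ∀ K, ∀ τ ∈ T K, ((νA K τ).map (a K)) Set.univ ≠ ∞ := fun K τ hτ => by
    haveI := hP.finite K τ hτ
    haveI := Measure.isFiniteMeasure_map (νA K τ) (a K)
    exact measure_ne_top _ _
  exact core_of_classSandwich_map₂ (r := fun K => r₁ K + 2 * r₂ K) ha hb hφ hφb hP hQ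
    (classSandwich_of_mass_of_shape (Ω := fun _ => X) (μA := fun K τ => (νA K τ).map (a K)) (μB := fun K τ => (νB K τ).map (b K))
      hfin hM (shapeSandwich_of_shapeDensity hD)) hw

end TwoKeys

/-! ## §2 At general key LEVELS of ONE scheme with a unit factorisation (MODULE B's output shape) -/

section AtKeys

variable {G O : Type*} {S : Missing.TorusScheme G O} [MeasurableSpace G] {X : Type*} [MeasurableSpace X]
  {ι : Type*} [DecidableEq ι] {l₀ vol : ℝ} {T : ℕ → Finset ι} {Bad : ℕ → ℝ → Finset ι}
  {kA kB : ℕ → ℕ} {νA : ∀ K, ι → Measure (GaugeField (S.P (kA K)) 0 G)} {νB : ∀ K, ι → Measure (GaugeField (S.P (kB K)) 0 G)}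
  {P Q : ℕ → ℝ → ι → ℝ} {r r₁ r₂ δ : ℕ → ℝ}

/-- **THE U3 FACE FOR N14 AT GENERAL KEY LEVELS** [folklore]: ONE scheme `S`, ANY unit factorisation `N` (tree: `T4RunLadder.unitFactorisation`; `prodObs S k os = prodW ∘ A k`
by module 26's `prodObs_eq_prodW_comp_A`, `|prodW| ≤ 1`), key levels `kA kB : ℕ → ℕ`, finite class measures on run A's spaces, and SHAPE_cl in density form for the class
measures pushed to the unit lattice by `N.A (kA K)` ∕ `N.A (kB K)` ⇒ `TiltedMeanMatching l₀ T Bad (K ↦ prodObs S (kA K) os) νA (K ↦ prodObs S (kB K) os) νB (K ↦ e^{2 r K} − 1)`.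
[folklore] -/
theorem tiltedMeanMatching_of_shapeDensity_atKeys (N : T4VarianceMatching.UnitFactorisation S X) (os : List O)
    (hfin : ∀ K, ∀ τ ∈ T K, IsFiniteMeasure (νA K τ))
    (hD : ∀ (K : ℕ) (t : ℝ), |t| ≤ l₀ → ∀ τ ∈ T K \ Bad K t, ∃ (c : ℝ) (g : X → ℝ), Measurable g ∧ (∀ x, |g x| ≤ r K) ∧
      (νB K τ).map (N.A (kB K)) = ENNReal.ofReal (Real.exp c) • ((νA K τ).map (N.A (kA K))).withDensity fun x => ENNReal.ofReal (Real.exp (g x)))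
    (hr : ∀ K, 0 ≤ r K) :
    TiltedMeanMatching l₀ T Bad (fun K => T4GenFunBounds.prodObs S (kA K) os) νA (fun K => T4GenFunBounds.prodObs S (kB K) os) νB
      fun K => Real.exp (2 * r K) - 1 := by
  have hA : (fun K => T4GenFunBounds.prodObs S (kA K) os) = fun K => (fun u => (os.map fun o => N.W o u).prod) ∘ N.A (kA K) :=
    funext fun K => prodObs_eq_prodW_comp_A N (kA K) os
  have hB : (fun K => T4GenFunBounds.prodObs S (kB K) os) = fun K => (fun u => (os.map fun o => N.W o u).prod) ∘ N.A (kB K) :=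
    funext fun K => prodObs_eq_prodW_comp_A N (kB K) os
  rw [hA, hB]
  have h := tiltedMeanMatching_of_shapeDensity_map₂ (ΩA := fun K => GaugeField (S.P (kA K)) 0 G) (ΩB := fun K => GaugeField (S.P (kB K)) 0 G)
    (a := fun K => N.A (kA K)) (b := fun K => N.A (kB K)) (T := T) (Bad := Bad) (l₀ := l₀) (νA := νA) (νB := νB)
    (fun K => N.measurable_A (kA K)) (fun K => N.measurable_A (kB K))
    (measurable_prodW N os) (abs_prodW_le_one N os) zero_le_one hfin hD hr
  intro K t ht τ hτ s hs
  have hK := h K t ht τ hτ s hs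
  simp only [one_mul] at hK ⊢
  exact hK

/-- **THE JOINT FACE AT GENERAL KEY LEVELS** [folklore]: MODULE B's two MGF forms (`Bo = 1`) + MASS_cl(`r₁`) + SHAPE-density(`r₂`) for the class measures pushed to the unit
lattice + `r₁ K + 2 r₂ K ≤ vol·δ K` ⇒ the dressed `Core l₀ vol T Bad P Q δ` AND `TiltedMeanMatching … (K ↦ e^{2 r₂ K} − 1)`. [folklore] -/
theorem core_and_tiltedMeanMatching_of_mass_of_shapeDensity_atKeys (N : T4VarianceMatching.UnitFactorisation S X) (os : List O)
    (hP : MGFForm 1 T (fun K => T4GenFunBounds.prodObs S (kA K) os) νA P)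
    (hQ : MGFForm 1 T (fun K => T4GenFunBounds.prodObs S (kB K) os) νB Q)
    (hM : ∀ K : ℕ, ∃ c : ℝ, ∀ t : ℝ, |t| ≤ l₀ → ∀ τ ∈ T K \ Bad K t,
      ENNReal.ofReal (Real.exp (c - r₁ K)) * ((νA K τ).map (N.A (kA K))) Set.univ ≤ ((νB K τ).map (N.A (kB K))) Set.univ ∧
        ((νB K τ).map (N.A (kB K))) Set.univ ≤ ENNReal.ofReal (Real.exp (c + r₁ K)) * ((νA K τ).map (N.A (kA K))) Set.univ)
    (hD : ∀ (K : ℕ) (t : ℝ), |t| ≤ l₀ → ∀ τ ∈ T K \ Bad K t, ∃ (c : ℝ) (g : X → ℝ), Measurable g ∧ (∀ x, |g x| ≤ r₂ K) ∧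
      (νB K τ).map (N.A (kB K)) = ENNReal.ofReal (Real.exp c) • ((νA K τ).map (N.A (kA K))).withDensity fun x => ENNReal.ofReal (Real.exp (g x)))
    (hr₂ : ∀ K, 0 ≤ r₂ K) (hw : ∀ K, r₁ K + 2 * r₂ K ≤ vol * δ K) :
    Core l₀ vol T Bad P Q δ ∧
      TiltedMeanMatching l₀ T Bad (fun K => T4GenFunBounds.prodObs S (kA K) os) νA (fun K => T4GenFunBounds.prodObs S (kB K) os) νB
        fun K => Real.exp (2 * r₂ K) - 1 := by
  refine ⟨?_, tiltedMeanMatching_of_shapeDensity_atKeys N os hP.finite hD hr₂⟩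
  have hA : (fun K => T4GenFunBounds.prodObs S (kA K) os) = fun K => (fun u => (os.map fun o => N.W o u).prod) ∘ N.A (kA K) :=
    funext fun K => prodObs_eq_prodW_comp_A N (kA K) os
  have hB : (fun K => T4GenFunBounds.prodObs S (kB K) os) = fun K => (fun u => (os.map fun o => N.W o u).prod) ∘ N.A (kB K) :=
    funext fun K => prodObs_eq_prodW_comp_A N (kB K) os
  rw [hA] at hP; rw [hB] at hQ
  exact (core_and_tiltedMeanMatching_of_mass_of_shapeDensity_map₂ (ΩA := fun K => GaugeField (S.P (kA K)) 0 G)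
    (ΩB := fun K => GaugeField (S.P (kB K)) 0 G) (a := fun K => N.A (kA K)) (b := fun K => N.A (kB K))
    (fun K => N.measurable_A (kA K)) (fun K => N.measurable_A (kB K)) (measurable_prodW N os) (abs_prodW_le_one N os) hP hQ hM hD hr₂ hw).1

end AtKeys

/-! ## §3 ★ AT THE RECORD's KEYS: the knit with MODULE B (`…N19MGFFormAtRecord`) — module 26's binder prefix verbatim, `hS` ↦ `hSh` -/

section AtRecord

open Literature.MathematicalPhysics.QuantumFieldTheory.Balaban1983to89.Node00
open T4Continuum B14.Eq218Concrete
open Summit.QuantumFields.YangMills.BalabanUVNodes.N19MGFKernelTower (classMeasureOfSlots)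
open Summit.QuantumFields.YangMills.BalabanUVNodes.N19MGFFormAtRecord (mgfForm_classWeightOfDatum₉_of_ppSelId mgfForm_classWeightOfDatum₉_of_localBg)

variable {F : T4Family} {N : ℕ} [NeZero N] {ι : Type*} [DecidableEq ι] {l₀ vol : ℝ} {Bad : ℕ → ℝ → Finset ι} {r r₁ r₂ δ : ℕ → ℝ}

/-- **★★ THE U3 FACE FOR N14 AT THE RECORD's KEYS** [bookkeeping] — module 26's `core_classWeightOfDatum₉_of_classSandwich` with `hS` ↦ `hSh` and `Core` ↦ `TiltedMeanMatching`:
two runs of the record keyed by `pA pB : ℕ → RunParams` (slot data `gA kA eA` ∕ `gB kB eB`), a Stage-9 tuple `ϑ` at the identity selector with the displayed `w`∕`χ` laws (MODULE B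
`mgfForm_classWeightOfDatum₉_of_ppSelId`, p494399), the CANONICAL unit factorisation `T4RunLadder.unitFactorisation D hD g₀` of the datum's scheme, and THE U3 READ-OUT SENTENCE `hSh` =
SHAPE_cl in density form for the two CLASS MEASURES OF SLOTS pushed to the unit lattice `GaugeField (F.P 0) 0 (SU N)` by `A_{(pA K).K}` ∕ `A_{(pB K).K}` ⇒ N14's binder
`TiltedMeanMatching l₀ T Bad (K ↦ prodObs (D.scheme g₀) (pA K).K os) (run A's class measures of slots) (K ↦ prodObs (D.scheme g₀) (pB K).K os) (run B's) (K ↦ e^{2 r K} − 1)` — the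
(I)-slot of 24bᴴ at MODULE B's `Fo ν Fo' ν'`.  ZERO estimate content: `hSh` is the residual (produced by nobody). [folklore] -/
theorem tiltedMeanMatching_classMeasureOfSlots_of_shapeDensity (ϑ : Stage9Params F N) (hsel : ϑ.ppSel = ppSelIdOfRecord F ϑ.ν ϑ.τ9.M)
    (hw0 : ∀ p g k s' U V', 0 ≤ wOfRecord₉ F N ϑ p g k s' U V') (hw1 : ∀ p g k s' U V', wOfRecord₉ F N ϑ p g k s' U V' ≤ 1)
    (hwm : ∀ (p : B12.RunParams) (g : ℕ → ℝ) k s',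
      Measurable fun z : GaugeField (F.P p.K) (k + 1) (SU N) × GaugeField (F.P p.K) k (SU N) => wOfRecord₉ F N ϑ p g k s' z.2 z.1)
    (hχm : ∀ (p : B12.RunParams) (g : ℕ → ℝ) k s, Measurable (chiSeqOfRecord F N ϑ.ν ϑ.τ9.M g p.K k s))
    (D : FiniteEpsData F (SU N)) (hD : D.AvgMeasurable) (g₀ : ℕ → ℝ) (os : List (ULoop F))
    (pA pB : ℕ → B12.RunParams) (gA gB : ℕ → ℕ → ℝ) (kA kB : ℕ → ℕ) (T : ℕ → Finset ι)
    (eA : ∀ K, ι → SeqOfRecord F ϑ.ν ϑ.τ9.M (gA K) (pA K).K (kA K)) (eB : ∀ K, ι → SeqOfRecord F ϑ.ν ϑ.τ9.M (gB K) (pB K).K (kB K))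
    (hSh : ∀ (K : ℕ) (t : ℝ), |t| ≤ l₀ → ∀ τ ∈ T K \ Bad K t, ∃ (c : ℝ) (g : GaugeField (F.P 0) 0 (SU N) → ℝ), Measurable g ∧ (∀ x, |g x| ≤ r K) ∧
      (classMeasureOfSlots F N ϑ.ν ϑ.τ9 (wOfRecord₉ F N ϑ) (pB K) (gB K) (Missing.boltzmann (F.P (pB K).K) ((g₀ (pB K).K)⁻¹ ^ 2))
          (kB K) (eB K τ)).map ((T4RunLadder.unitFactorisation D hD g₀).A (pB K).K) =
        ENNReal.ofReal (Real.exp c) •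
          ((classMeasureOfSlots F N ϑ.ν ϑ.τ9 (wOfRecord₉ F N ϑ) (pA K) (gA K) (Missing.boltzmann (F.P (pA K).K) ((g₀ (pA K).K)⁻¹ ^ 2))
            (kA K) (eA K τ)).map ((T4RunLadder.unitFactorisation D hD g₀).A (pA K).K)).withDensity fun x => ENNReal.ofReal (Real.exp (g x)))
    (hr : ∀ K, 0 ≤ r K) :
    TiltedMeanMatching l₀ T Bad (fun K => T4GenFunBounds.prodObs (D.scheme g₀) (pA K).K os)
      (fun K τ => classMeasureOfSlots F N ϑ.ν ϑ.τ9 (wOfRecord₉ F N ϑ) (pA K) (gA K) (Missing.boltzmann (F.P (pA K).K) ((g₀ (pA K).K)⁻¹ ^ 2))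
        (kA K) (eA K τ))
      (fun K => T4GenFunBounds.prodObs (D.scheme g₀) (pB K).K os)
      (fun K τ => classMeasureOfSlots F N ϑ.ν ϑ.τ9 (wOfRecord₉ F N ϑ) (pB K) (gB K) (Missing.boltzmann (F.P (pB K).K) ((g₀ (pB K).K)⁻¹ ^ 2))
        (kB K) (eB K τ))
      fun K => Real.exp (2 * r K) - 1 :=
  tiltedMeanMatching_of_shapeDensity_atKeys (T4RunLadder.unitFactorisation D hD g₀) os
    (mgfForm_classWeightOfDatum₉_of_ppSelId ϑ hsel hw0 hw1 hwm hχm D hD g₀ os pA gA kA T eA).finite hSh hr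

/-- **… WITH THE LAWS FROM NODE 00's ROWS** [bookkeeping] (MODULE B `mgfForm_classWeightOfDatum₉_of_localBg` in place of `_of_ppSelId`, as module 26's `…_of_localBg`): identity selector,
(H-U) `LocalBgMeasurable ϑ.ν`, `ZetaMeasurable ϑ.ζ`, `0 ≤ ζ`, `|ζ| ≤ 1` — the displayed `w`∕`χ` laws discharged. [folklore] -/
theorem tiltedMeanMatching_classMeasureOfSlots_of_shapeDensity_of_localBg (ϑ : Stage9Params F N) (hsel : ϑ.ppSel = ppSelIdOfRecord F ϑ.ν ϑ.τ9.M)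
    (hU : LocalBgMeasurable F N ϑ.ν) (hζm : ZetaMeasurable F N ϑ.ζ) (hζ0 : ∀ p g k s Pl Ql RS U V', 0 ≤ ϑ.ζ p g k s Pl Ql RS U V')
    (hζ1 : IsZetaAbsLeOne F N ϑ.ν ϑ.τ9.M ϑ.ζ) (D : FiniteEpsData F (SU N)) (hD : D.AvgMeasurable) (g₀ : ℕ → ℝ) (os : List (ULoop F))
    (pA pB : ℕ → B12.RunParams) (gA gB : ℕ → ℕ → ℝ) (kA kB : ℕ → ℕ) (T : ℕ → Finset ι)
    (eA : ∀ K, ι → SeqOfRecord F ϑ.ν ϑ.τ9.M (gA K) (pA K).K (kA K)) (eB : ∀ K, ι → SeqOfRecord F ϑ.ν ϑ.τ9.M (gB K) (pB K).K (kB K))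
    (hSh : ∀ (K : ℕ) (t : ℝ), |t| ≤ l₀ → ∀ τ ∈ T K \ Bad K t, ∃ (c : ℝ) (g : GaugeField (F.P 0) 0 (SU N) → ℝ), Measurable g ∧ (∀ x, |g x| ≤ r K) ∧
      (classMeasureOfSlots F N ϑ.ν ϑ.τ9 (wOfRecord₉ F N ϑ) (pB K) (gB K) (Missing.boltzmann (F.P (pB K).K) ((g₀ (pB K).K)⁻¹ ^ 2))
          (kB K) (eB K τ)).map ((T4RunLadder.unitFactorisation D hD g₀).A (pB K).K) =
        ENNReal.ofReal (Real.exp c) •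
          ((classMeasureOfSlots F N ϑ.ν ϑ.τ9 (wOfRecord₉ F N ϑ) (pA K) (gA K) (Missing.boltzmann (F.P (pA K).K) ((g₀ (pA K).K)⁻¹ ^ 2))
            (kA K) (eA K τ)).map ((T4RunLadder.unitFactorisation D hD g₀).A (pA K).K)).withDensity fun x => ENNReal.ofReal (Real.exp (g x)))
    (hr : ∀ K, 0 ≤ r K) :
    TiltedMeanMatching l₀ T Bad (fun K => T4GenFunBounds.prodObs (D.scheme g₀) (pA K).K os)
      (fun K τ => classMeasureOfSlots F N ϑ.ν ϑ.τ9 (wOfRecord₉ F N ϑ) (pA K) (gA K) (Missing.boltzmann (F.P (pA K).K) ((g₀ (pA K).K)⁻¹ ^ 2))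
        (kA K) (eA K τ))
      (fun K => T4GenFunBounds.prodObs (D.scheme g₀) (pB K).K os)
      (fun K τ => classMeasureOfSlots F N ϑ.ν ϑ.τ9 (wOfRecord₉ F N ϑ) (pB K) (gB K) (Missing.boltzmann (F.P (pB K).K) ((g₀ (pB K).K)⁻¹ ^ 2))
        (kB K) (eB K τ))
      fun K => Real.exp (2 * r K) - 1 :=
  tiltedMeanMatching_of_shapeDensity_atKeys (T4RunLadder.unitFactorisation D hD g₀) os
    (mgfForm_classWeightOfDatum₉_of_localBg ϑ hsel hU hζm hζ0 hζ1 D hD g₀ os pA gA kA T eA).finite hSh hr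

/-- **★★ THE (I)-SLOT PAIR AT THE RECORD** [bookkeeping]: with `Σ r K < ∞`, `∃ η, TiltedMeanMatching … η ∧ Summable η` for MODULE B's observables and class measures of slots — the
exact pair `hη`∕`hηs` that `N19VacuumMGFRoad.coreEdge_of_coreZero_mgfForm` (hence 24bᴴ `towerEdge₁₃CoPHOn_of_vacuumCoreMGFReading`) consumes beside the vacuum `Core`. [folklore] -/
theorem exists_tiltedMeanMatching_summable_classMeasureOfSlots_of_shapeDensity (ϑ : Stage9Params F N) (hsel : ϑ.ppSel = ppSelIdOfRecord F ϑ.ν ϑ.τ9.M)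
    (hw0 : ∀ p g k s' U V', 0 ≤ wOfRecord₉ F N ϑ p g k s' U V') (hw1 : ∀ p g k s' U V', wOfRecord₉ F N ϑ p g k s' U V' ≤ 1)
    (hwm : ∀ (p : B12.RunParams) (g : ℕ → ℝ) k s',
      Measurable fun z : GaugeField (F.P p.K) (k + 1) (SU N) × GaugeField (F.P p.K) k (SU N) => wOfRecord₉ F N ϑ p g k s' z.2 z.1)
    (hχm : ∀ (p : B12.RunParams) (g : ℕ → ℝ) k s, Measurable (chiSeqOfRecord F N ϑ.ν ϑ.τ9.M g p.K k s))
    (D : FiniteEpsData F (SU N)) (hD : D.AvgMeasurable) (g₀ : ℕ → ℝ) (os : List (ULoop F))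
    (pA pB : ℕ → B12.RunParams) (gA gB : ℕ → ℕ → ℝ) (kA kB : ℕ → ℕ) (T : ℕ → Finset ι)
    (eA : ∀ K, ι → SeqOfRecord F ϑ.ν ϑ.τ9.M (gA K) (pA K).K (kA K)) (eB : ∀ K, ι → SeqOfRecord F ϑ.ν ϑ.τ9.M (gB K) (pB K).K (kB K))
    (hSh : ∀ (K : ℕ) (t : ℝ), |t| ≤ l₀ → ∀ τ ∈ T K \ Bad K t, ∃ (c : ℝ) (g : GaugeField (F.P 0) 0 (SU N) → ℝ), Measurable g ∧ (∀ x, |g x| ≤ r K) ∧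
      (classMeasureOfSlots F N ϑ.ν ϑ.τ9 (wOfRecord₉ F N ϑ) (pB K) (gB K) (Missing.boltzmann (F.P (pB K).K) ((g₀ (pB K).K)⁻¹ ^ 2))
          (kB K) (eB K τ)).map ((T4RunLadder.unitFactorisation D hD g₀).A (pB K).K) =
        ENNReal.ofReal (Real.exp c) •
          ((classMeasureOfSlots F N ϑ.ν ϑ.τ9 (wOfRecord₉ F N ϑ) (pA K) (gA K) (Missing.boltzmann (F.P (pA K).K) ((g₀ (pA K).K)⁻¹ ^ 2))
            (kA K) (eA K τ)).map ((T4RunLadder.unitFactorisation D hD g₀).A (pA K).K)).withDensity fun x => ENNReal.ofReal (Real.exp (g x)))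
    (hr : ∀ K, 0 ≤ r K) (hrs : Summable r) :
    ∃ η : ℕ → ℝ, TiltedMeanMatching l₀ T Bad (fun K => T4GenFunBounds.prodObs (D.scheme g₀) (pA K).K os)
      (fun K τ => classMeasureOfSlots F N ϑ.ν ϑ.τ9 (wOfRecord₉ F N ϑ) (pA K) (gA K) (Missing.boltzmann (F.P (pA K).K) ((g₀ (pA K).K)⁻¹ ^ 2))
        (kA K) (eA K τ))
      (fun K => T4GenFunBounds.prodObs (D.scheme g₀) (pB K).K os)
      (fun K τ => classMeasureOfSlots F N ϑ.ν ϑ.τ9 (wOfRecord₉ F N ϑ) (pB K) (gB K) (Missing.boltzmann (F.P (pB K).K) ((g₀ (pB K).K)⁻¹ ^ 2))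
        (kB K) (eB K τ)) η ∧ Summable η := by
  refine ⟨_, tiltedMeanMatching_classMeasureOfSlots_of_shapeDensity ϑ hsel hw0 hw1 hwm hχm D hD g₀ os pA pB gA gB kA kB T eA eB hSh hr, ?_⟩
  have h := summable_mul_exp_two_mul_sub_one hrs hr 1
  simpa only [one_mul] using h

/-- **★ THE JOINT FACE AT THE RECORD's KEYS** [bookkeeping]: MASS_cl(`r₁`) of the two pushed-forward class masses + THE U3 READ-OUT SENTENCE `hSh` (SHAPE-density, `r₂`) +
`r₁ K + 2 r₂ K ≤ vol·δ K` ⇒ module 26's dressed `Spine.NE7.Core` for F3's class weights `classWeightOfDatum₉` AND N14's `TiltedMeanMatching` for MODULE B's observables ∕ class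
measures — N19's (V)+(shape) road and N14's binder from ONE displayed U3 sentence pair.  ZERO estimate content (both sandwiches are the residual). [folklore] -/
theorem core_and_tiltedMeanMatching_classWeightOfDatum₉_of_mass_of_shapeDensity (ϑ : Stage9Params F N) (hsel : ϑ.ppSel = ppSelIdOfRecord F ϑ.ν ϑ.τ9.M)
    (hw0 : ∀ p g k s' U V', 0 ≤ wOfRecord₉ F N ϑ p g k s' U V') (hw1 : ∀ p g k s' U V', wOfRecord₉ F N ϑ p g k s' U V' ≤ 1)
    (hwm : ∀ (p : B12.RunParams) (g : ℕ → ℝ) k s',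
      Measurable fun z : GaugeField (F.P p.K) (k + 1) (SU N) × GaugeField (F.P p.K) k (SU N) => wOfRecord₉ F N ϑ p g k s' z.2 z.1)
    (hχm : ∀ (p : B12.RunParams) (g : ℕ → ℝ) k s, Measurable (chiSeqOfRecord F N ϑ.ν ϑ.τ9.M g p.K k s))
    (D : FiniteEpsData F (SU N)) (hD : D.AvgMeasurable) (g₀ : ℕ → ℝ) (os : List (ULoop F))
    (pA pB : ℕ → B12.RunParams) (gA gB : ℕ → ℕ → ℝ) (kA kB : ℕ → ℕ) (T : ℕ → Finset ι)
    (eA : ∀ K, ι → SeqOfRecord F ϑ.ν ϑ.τ9.M (gA K) (pA K).K (kA K)) (eB : ∀ K, ι → SeqOfRecord F ϑ.ν ϑ.τ9.M (gB K) (pB K).K (kB K))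
    (hM : ∀ K : ℕ, ∃ c : ℝ, ∀ t : ℝ, |t| ≤ l₀ → ∀ τ ∈ T K \ Bad K t,
      ENNReal.ofReal (Real.exp (c - r₁ K)) *
          ((classMeasureOfSlots F N ϑ.ν ϑ.τ9 (wOfRecord₉ F N ϑ) (pA K) (gA K) (Missing.boltzmann (F.P (pA K).K) ((g₀ (pA K).K)⁻¹ ^ 2))
            (kA K) (eA K τ)).map ((T4RunLadder.unitFactorisation D hD g₀).A (pA K).K)) Set.univ ≤
        ((classMeasureOfSlots F N ϑ.ν ϑ.τ9 (wOfRecord₉ F N ϑ) (pB K) (gB K) (Missing.boltzmann (F.P (pB K).K) ((g₀ (pB K).K)⁻¹ ^ 2))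
            (kB K) (eB K τ)).map ((T4RunLadder.unitFactorisation D hD g₀).A (pB K).K)) Set.univ ∧
      ((classMeasureOfSlots F N ϑ.ν ϑ.τ9 (wOfRecord₉ F N ϑ) (pB K) (gB K) (Missing.boltzmann (F.P (pB K).K) ((g₀ (pB K).K)⁻¹ ^ 2))
            (kB K) (eB K τ)).map ((T4RunLadder.unitFactorisation D hD g₀).A (pB K).K)) Set.univ ≤
        ENNReal.ofReal (Real.exp (c + r₁ K)) *
          ((classMeasureOfSlots F N ϑ.ν ϑ.τ9 (wOfRecord₉ F N ϑ) (pA K) (gA K) (Missing.boltzmann (F.P (pA K).K) ((g₀ (pA K).K)⁻¹ ^ 2))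
            (kA K) (eA K τ)).map ((T4RunLadder.unitFactorisation D hD g₀).A (pA K).K)) Set.univ)
    (hSh : ∀ (K : ℕ) (t : ℝ), |t| ≤ l₀ → ∀ τ ∈ T K \ Bad K t, ∃ (c : ℝ) (g : GaugeField (F.P 0) 0 (SU N) → ℝ), Measurable g ∧ (∀ x, |g x| ≤ r₂ K) ∧
      (classMeasureOfSlots F N ϑ.ν ϑ.τ9 (wOfRecord₉ F N ϑ) (pB K) (gB K) (Missing.boltzmann (F.P (pB K).K) ((g₀ (pB K).K)⁻¹ ^ 2))
          (kB K) (eB K τ)).map ((T4RunLadder.unitFactorisation D hD g₀).A (pB K).K) =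
        ENNReal.ofReal (Real.exp c) •
          ((classMeasureOfSlots F N ϑ.ν ϑ.τ9 (wOfRecord₉ F N ϑ) (pA K) (gA K) (Missing.boltzmann (F.P (pA K).K) ((g₀ (pA K).K)⁻¹ ^ 2))
            (kA K) (eA K τ)).map ((T4RunLadder.unitFactorisation D hD g₀).A (pA K).K)).withDensity fun x => ENNReal.ofReal (Real.exp (g x)))
    (hr₂ : ∀ K, 0 ≤ r₂ K) (hw : ∀ K, r₁ K + 2 * r₂ K ≤ vol * δ K) :
    Core l₀ vol T Bad (fun K t τ => classWeightOfDatum₉ F N ϑ D g₀ os (pA K) (gA K) (kA K) t (eA K τ))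
        (fun K t τ => classWeightOfDatum₉ F N ϑ D g₀ os (pB K) (gB K) (kB K) t (eB K τ)) δ ∧
      TiltedMeanMatching l₀ T Bad (fun K => T4GenFunBounds.prodObs (D.scheme g₀) (pA K).K os)
        (fun K τ => classMeasureOfSlots F N ϑ.ν ϑ.τ9 (wOfRecord₉ F N ϑ) (pA K) (gA K) (Missing.boltzmann (F.P (pA K).K) ((g₀ (pA K).K)⁻¹ ^ 2))
          (kA K) (eA K τ))
        (fun K => T4GenFunBounds.prodObs (D.scheme g₀) (pB K).K os)
        (fun K τ => classMeasureOfSlots F N ϑ.ν ϑ.τ9 (wOfRecord₉ F N ϑ) (pB K) (gB K) (Missing.boltzmann (F.P (pB K).K) ((g₀ (pB K).K)⁻¹ ^ 2))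
          (kB K) (eB K τ))
        fun K => Real.exp (2 * r₂ K) - 1 :=
  core_and_tiltedMeanMatching_of_mass_of_shapeDensity_atKeys (T4RunLadder.unitFactorisation D hD g₀) os
    (mgfForm_classWeightOfDatum₉_of_ppSelId ϑ hsel hw0 hw1 hwm hχm D hD g₀ os pA gA kA T eA)
    (mgfForm_classWeightOfDatum₉_of_ppSelId ϑ hsel hw0 hw1 hwm hχm D hD g₀ os pB gB kB T eB) hM hSh hr₂ hw

end AtRecord

end Summit.QuantumFields.YangMills.BalabanUVNodes.N19ShapeFaceN14AtRecord

end
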